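import Mathlib.Analysis.Convex.Deriv
import Mathlib.Analysis.SpecialFunctions.Log.Deriv
import Summits.Ventures.LatticeQCDFlow.Scaling.SwapLadderMinimax
import Summits.Ventures.LatticeQCDFlow.Scaling.SwapSpacingOptimum

/-!
HONEST FRAMING: exact (Metropolis-corrected) sampling algorithms for lattice gauge theory; figures
of merit are autocorrelation/cost numbers at stated couplings and volumes; no continuum-physics
claim.

# SwapLadderLogConcave — `erfc` IS LOG-CONCAVE, SO IN THE GAUSSIAN SWAP MODEL THE EQUAL-STIFFNESS
# LADDER MAXIMISES BOTH THE WORST AND THE PRODUCT OF THE ADJACENT SWAP ACCEPTANCES, AND EVERY TARGET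
# `p ∈ (0, 1)` HAS A UNIQUE STIFFNESS GAP `ℓ_p` (row 22 `su3-ptbc`, GEN-4, ours; docks the abstract
# `Scaling/SwapLadderMinimax` to the model of `Scaling/SwapSpacingOptimum`)

Venture `LatticeQCDFlow` (cell pub-lqcd), topic `Scaling`; FANOUT row 22 (`su3-ptbc`).  NEW WORK of the
cell over the tree (`SwapLadderMinimax`: `exists_acceptance_le`, `prod_acceptance_le_pow`,
`forall_acceptance_uniformLadder_iff` for an abstract antitone / log-concave acceptance-of-gap function;
`SwapSpacingOptimum`: `hasDerivAt_erfc`, `strictAnti_erfc`, `continuous_erfc`, `erfc_zero`;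
Literature `erfc_pos`, `erfc_lt_leadFactor` = `erfc x < e^{−x²}/(x√π)`).  Nothing is cited as a fact.
Printed counterparts NAMED ONLY: log-concavity of the Gaussian tail / monotonicity of the Mills ratio
(folklore; e.g. Baricz, J. Math. Anal. Appl. 340 (2008) 1362); Shenfeld–Xu–Eastwood–Dror–Shaw,
Phys. Rev. E 80 (2009) 046705 Thm 2 (equidistant replicas in thermodynamic length maximise the total
acceptance, to second order); here exact in the model.

## What is proved

* §1 **`mul_erfc_lt`** — `x·erfc x < e^{−x²}/√π` for EVERY real `x` (the Mills-ratio inequality; for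
  `x > 0` it is the tree's `erfc_lt_leadFactor`, for `x ≤ 0` trivial); `erfcLogDeriv x =
  −(2/√π)e^{−x²}/erfc x`, `hasDerivAt_log_erfc`, `hasDerivAt_erfcLogDeriv` (its derivative is
  `(2/√π)e^{−x²}·2(x erfc x − e^{−x²}/√π)/erfc² < 0`), **`strictAnti_erfcLogDeriv`**, and
  **`concaveOn_log_erfc`**: `log ∘ erfc` is concave on `ℝ` — `erfc` IS LOG-CONCAVE.
* §2 the Gaussian-model acceptance of a pair at stiffness gap `ℓ`, **`gaussAcc ℓ = erfc(ℓ/(2√2))`**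
  (`= aOpt` at `ℓ = optSpacing`): `gaussAcc_pos`, `strictAnti_gaussAcc`, `gaussAcc_zero = 1`,
  `hasDerivAt_log_gaussAcc`, **`concaveOn_log_gaussAcc`**.
* §3 DOCKING to `SwapLadderMinimax` (every `K`-interval ladder `g`, `K ≥ 1`, total stiffness
  `Λ = g K − g 0`, NO sign or size condition on the gaps): **`exists_gaussAcc_le`** (some adjacent pair
  accepts `≤ erfc(Λ/(2√2K))`), **`prod_gaussAcc_le_pow`** (`Π_i erfc(gap_i/(2√2)) ≤ erfc(Λ/(2√2K))^K`,
  attained by the uniform ladder: `prod_gaussAcc_uniformLadder`) — the equal-stiffness ladder of the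
  card's §1.6 maximises the worst AND the product of the acceptances in the model.
* §4 **`exists_unique_gaussAcc_eq`** — every target `p ∈ (0, 1)` is the acceptance of exactly one gap
  `ℓ_p > 0` (IVT + strict monotonicity; `erfc x < 1/(x√π)` bounds the tail), so the card's
  `N_r(p*) − 1 = G_tot/ℓ_{p*}` is well defined for every `p*`; **`forall_gaussAcc_uniformLadder_iff`** —
  the uniform `K`-ladder of stiffness `Λ` has all acceptances `≥ p` iff `Λ/ℓ_p ≤ K`, and
  (`SwapLadderMinimax.length_div_level_le_of_forall_acceptance`) no ladder does it with fewer.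

NOT CLAIMED: that PTBC acceptances follow the model (CARD §9 measures it); anything about a run.
-/

noncomputable section

open Real Set Finset
open Literature.ComputerArithmetic.BrentZimmermann2010.AsymptoticExpansions (erfc leadFactor erfc_pos
  erfc_lt_leadFactor)

namespace Summit.Ventures.LatticeQCDFlow.Scaling

/-! ## §1 `erfc` is log-concave -/

section LogConcave

/-- **Mills-ratio inequality**: `x·erfc x < e^{−x²}/√π` for every real `x`. [folklore] -/
theorem mul_erfc_lt (x : ℝ) : x * erfc x < exp (-(x ^ 2)) / sqrt π := by
  rcases le_or_gt x 0 with hx | hx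
  · have h1 : x * erfc x ≤ 0 := mul_nonpos_of_nonpos_of_nonneg hx (erfc_pos x).le
    have h2 : 0 < exp (-(x ^ 2)) / sqrt π := by positivity
    linarith
  · have h := erfc_lt_leadFactor hx
    unfold leadFactor at h
    have hπ : 0 < sqrt π := by positivity
    calc x * erfc x < x * (exp (-(x ^ 2)) / (x * sqrt π)) := by gcongr
      _ = exp (-(x ^ 2)) / sqrt π := by field_simp

/-- The logarithmic derivative of `erfc`: `erfcLogDeriv x = −(2/√π)e^{−x²}/erfc x`. [folklore] -/
def erfcLogDeriv (x : ℝ) : ℝ := -(2 / sqrt π * exp (-(x ^ 2))) / erfc x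

/-- `(log ∘ erfc)′ = erfcLogDeriv`. [folklore] -/
theorem hasDerivAt_log_erfc (x : ℝ) : HasDerivAt (fun y => Real.log (erfc y)) (erfcLogDeriv x) x :=
  (hasDerivAt_erfc x).log (erfc_pos x).ne'

/-- `deriv (log ∘ erfc) = erfcLogDeriv`. [folklore] -/
theorem deriv_log_erfc : deriv (fun y => Real.log (erfc y)) = erfcLogDeriv :=
  funext fun x => (hasDerivAt_log_erfc x).deriv

/-- The derivative of the logarithmic derivative:
`erfcLogDeriv′(x) = ((2/√π)e^{−x²}·2x·erfc x − ((2/√π)e^{−x²})²)/erfc(x)²`. [folklore] -/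
theorem hasDerivAt_erfcLogDeriv (x : ℝ) :
    HasDerivAt erfcLogDeriv
      ((2 / sqrt π * (exp (-(x ^ 2)) * (2 * x)) * erfc x
        - (-(2 / sqrt π * exp (-(x ^ 2)))) * (-(2 / sqrt π * exp (-(x ^ 2))))) / erfc x ^ 2) x := by
  have h0 : HasDerivAt (fun v : ℝ => v ^ 2) (2 * x) x := by simpa using hasDerivAt_pow 2 x
  have h1 : HasDerivAt (fun v : ℝ => -(v ^ 2)) (-(2 * x)) x := h0.neg
  have h2 : HasDerivAt (fun v : ℝ => exp (-(v ^ 2))) (exp (-(x ^ 2)) * (-(2 * x))) x := h1.exp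
  have h3 : HasDerivAt (fun v : ℝ => 2 / sqrt π * exp (-(v ^ 2)))
      (2 / sqrt π * (exp (-(x ^ 2)) * (-(2 * x)))) x := h2.const_mul _
  have h4 : HasDerivAt (fun v : ℝ => -(2 / sqrt π * exp (-(v ^ 2))))
      (-(2 / sqrt π * (exp (-(x ^ 2)) * (-(2 * x))))) x := h3.neg
  have h5 : HasDerivAt (fun v : ℝ => -(2 / sqrt π * exp (-(v ^ 2))) / erfc v)
      ((-(2 / sqrt π * (exp (-(x ^ 2)) * (-(2 * x)))) * erfc x
        - (-(2 / sqrt π * exp (-(x ^ 2)))) * (-(2 / sqrt π * exp (-(x ^ 2))))) / erfc x ^ 2) x :=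
    h4.div (hasDerivAt_erfc x) (erfc_pos x).ne'
  have e : (fun v : ℝ => -(2 / sqrt π * exp (-(v ^ 2))) / erfc v) = erfcLogDeriv := rfl
  rw [e] at h5
  convert h5 using 1
  ring

/-- **The logarithmic derivative of `erfc` is strictly decreasing** (its derivative is
`(2/√π)e^{−x²}·2(x·erfc x − e^{−x²}/√π)/erfc² < 0` by the Mills-ratio inequality). [folklore] -/
theorem strictAnti_erfcLogDeriv : StrictAnti erfcLogDeriv := by
  refine strictAnti_of_deriv_neg fun x => ?_
  rw [(hasDerivAt_erfcLogDeriv x).deriv]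
  have hE : 0 < exp (-(x ^ 2)) := exp_pos _
  have hc : 0 < 2 / sqrt π := by positivity
  have herfc : 0 < erfc x := erfc_pos x
  have hM := mul_erfc_lt x
  -- numerator = (2/√π) e^{−x²} · (2x·erfc x − (2/√π) e^{−x²}) = c E · 2 (x erfc x − E/√π) < 0
  have hnum : (2 / sqrt π * (exp (-(x ^ 2)) * (2 * x)) * erfc x
      - (-(2 / sqrt π * exp (-(x ^ 2)))) * (-(2 / sqrt π * exp (-(x ^ 2))))) < 0 := by
    have hπ : 0 < sqrt π := by positivity
    have key : (2 / sqrt π * (exp (-(x ^ 2)) * (2 * x)) * erfc x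
        - (-(2 / sqrt π * exp (-(x ^ 2)))) * (-(2 / sqrt π * exp (-(x ^ 2)))))
        = (2 / sqrt π * exp (-(x ^ 2))) * 2 * (x * erfc x - exp (-(x ^ 2)) / sqrt π) := by
      ring
    rw [key]
    have hneg : x * erfc x - exp (-(x ^ 2)) / sqrt π < 0 := by linarith
    have hpos : 0 < (2 / sqrt π * exp (-(x ^ 2))) * 2 := by positivity
    exact mul_neg_of_pos_of_neg hpos hneg
  exact div_neg_of_neg_of_pos hnum (by positivity)

/-- **`erfc` IS LOG-CONCAVE**: `log ∘ erfc` is concave on `ℝ`. [folklore] -/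
theorem concaveOn_log_erfc : ConcaveOn ℝ univ (fun y => Real.log (erfc y)) := by
  refine Antitone.concaveOn_univ_of_deriv (fun x => (hasDerivAt_log_erfc x).differentiableAt) ?_
  rw [deriv_log_erfc]
  exact strictAnti_erfcLogDeriv.antitone

end LogConcave

/-! ## §2 The Gaussian-model acceptance of a pair at stiffness gap `ℓ` -/

section Gauss

/-- **The Gaussian-model stationary swap acceptance** of two replicas at stiffness distance `ℓ`:
`gaussAcc ℓ = erfc(ℓ/(2√2))` (`= 2Φ(−ℓ/2)`; at `ℓ⋆ = optSpacing` it is `aOpt`, `erfc_optSpacing` of the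
sequel). [ours] -/
def gaussAcc (ℓ : ℝ) : ℝ := erfc (ℓ / (2 * sqrt 2))

/-- `gaussAcc ℓ > 0`. [ours] -/
theorem gaussAcc_pos (ℓ : ℝ) : 0 < gaussAcc ℓ := erfc_pos _

/-- `gaussAcc 0 = 1` (coincident replicas always swap). [ours] -/
theorem gaussAcc_zero : gaussAcc 0 = 1 := by simp [gaussAcc, erfc_zero]

/-- **`gaussAcc` is strictly decreasing in the gap.** [ours] -/
theorem strictAnti_gaussAcc : StrictAnti gaussAcc := fun a b hab =>
  strictAnti_erfc (div_lt_div_of_pos_right hab (by positivity))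

/-- `gaussAcc` is antitone. [ours] -/
theorem antitone_gaussAcc : Antitone gaussAcc := strictAnti_gaussAcc.antitone

/-- `gaussAcc` is continuous. [ours] -/
theorem continuous_gaussAcc : Continuous gaussAcc :=
  continuous_erfc.comp (continuous_id.div_const _)

/-- `(log ∘ gaussAcc)′(ℓ) = erfcLogDeriv(ℓ/(2√2))/(2√2)`. [ours] -/
theorem hasDerivAt_log_gaussAcc (ℓ : ℝ) :
    HasDerivAt (fun y => Real.log (gaussAcc y)) (erfcLogDeriv (ℓ / (2 * sqrt 2)) * (1 / (2 * sqrt 2))) ℓ := by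
  have h1 : HasDerivAt (fun y : ℝ => y / (2 * sqrt 2)) (1 / (2 * sqrt 2)) ℓ := (hasDerivAt_id ℓ).div_const _
  have h2 := (hasDerivAt_log_erfc (ℓ / (2 * sqrt 2))).comp ℓ h1
  exact h2

/-- **`log ∘ gaussAcc` is concave on `ℝ`** (the acceptance-of-gap function of the Gaussian swap model
is log-concave). [ours] -/
theorem concaveOn_log_gaussAcc : ConcaveOn ℝ univ (fun y => Real.log (gaussAcc y)) := by
  refine Antitone.concaveOn_univ_of_deriv (fun ℓ => (hasDerivAt_log_gaussAcc ℓ).differentiableAt) ?_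
  have hd : deriv (fun y => Real.log (gaussAcc y))
      = fun ℓ => erfcLogDeriv (ℓ / (2 * sqrt 2)) * (1 / (2 * sqrt 2)) :=
    funext fun ℓ => (hasDerivAt_log_gaussAcc ℓ).deriv
  rw [hd]
  intro a b hab
  have hc : (0 : ℝ) ≤ 1 / (2 * sqrt 2) := by positivity
  exact mul_le_mul_of_nonneg_right
    (strictAnti_erfcLogDeriv.antitone (div_le_div_of_nonneg_right hab (by positivity))) hc

end Gauss

/-! ## §3 Docking: in the model the equal-stiffness ladder maximises the worst and the product of the acceptances -/

section Dock

/-- **Some adjacent pair of every `K`-interval ladder of total stiffness `Λ` accepts at most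
`erfc(Λ/(2√2·K))`** (the common acceptance of the uniform ladder). [ours] -/
theorem exists_gaussAcc_le {K : ℕ} (hK : 0 < K) (g : ℕ → ℝ) :
    ∃ i ∈ range K, gaussAcc (ladderGap g i) ≤ gaussAcc ((g K - g 0) / K) :=
  exists_acceptance_le hK g antitone_gaussAcc

/-- **The product of the adjacent acceptances of EVERY `K`-interval ladder of total stiffness `Λ` is at
most `erfc(Λ/(2√2K))^K`** — log-concavity of `erfc` and Jensen; no condition on the gaps. [ours] -/
theorem prod_gaussAcc_le_pow {K : ℕ} (hK : 0 < K) (g : ℕ → ℝ) :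
    ∏ i ∈ range K, gaussAcc (ladderGap g i) ≤ gaussAcc ((g K - g 0) / K) ^ K :=
  prod_acceptance_le_pow hK g convex_univ (fun x _ => gaussAcc_pos x) concaveOn_log_gaussAcc
    (fun _ _ => mem_univ _)

/-- … and the uniform (equal-stiffness) ladder attains it. [ours] -/
theorem prod_gaussAcc_uniformLadder (g₀ Λ : ℝ) (K : ℕ) :
    ∏ i ∈ range K, gaussAcc (ladderGap (uniformLadder g₀ Λ K) i) = gaussAcc (Λ / K) ^ K :=
  prod_acceptance_uniformLadder g₀ Λ K gaussAcc

end Dock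

/-! ## §4 Every target acceptance `p ∈ (0,1)` has a unique gap `ℓ_p`; the replica-count law in the model -/

section Level

/-- `erfc x < 1/(x√π)` for `x > 0` (the leading asymptotic factor with `e^{−x²} ≤ 1`). [folklore] -/
theorem erfc_lt_inv_mul (x : ℝ) (hx : 0 < x) : erfc x < 1 / (x * sqrt π) := by
  have h := erfc_lt_leadFactor hx
  unfold leadFactor at h
  have h2 : exp (-(x ^ 2)) / (x * sqrt π) ≤ 1 / (x * sqrt π) :=
    div_le_div_of_nonneg_right (exp_le_one_iff.mpr (by nlinarith)) (by positivity)
  exact h.trans_le h2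

/-- **Every `p ∈ (0, 1)` is the Gaussian-model acceptance of exactly one gap `ℓ_p`, and `ℓ_p > 0`.**
[ours] -/
theorem exists_unique_gaussAcc_eq {p : ℝ} (hp0 : 0 < p) (hp1 : p < 1) :
    ∃! ℓ : ℝ, gaussAcc ℓ = p := by
  -- a point where the acceptance is already below `p`: `X = 2√2·x` with `x = 1/(p√π) + 1`
  set x : ℝ := 1 / (p * sqrt π) + 1 with hxdef
  have hπ : 0 < sqrt π := by positivity
  have hx : 0 < x := by positivity
  have hlow : erfc x < p := by
    have h1 := erfc_lt_inv_mul x hx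
    have h2 : 1 / (x * sqrt π) < p := by
      rw [div_lt_iff₀ (by positivity)]
      have : x * sqrt π = 1 / p + sqrt π := by
        rw [hxdef]; field_simp
      rw [this]
      have hp' : p * (1 / p) = 1 := by field_simp
      nlinarith
    exact h1.trans h2
  set X : ℝ := 2 * sqrt 2 * x with hXdef
  have hX : gaussAcc X = erfc x := by
    simp only [gaussAcc, hXdef]
    rw [mul_div_cancel_left₀ _ (by positivity : (2 : ℝ) * sqrt 2 ≠ 0)]
  have hX0 : 0 ≤ X := by positivity
  obtain ⟨ℓ, _, hℓ⟩ := intermediate_value_Ioo' hX0 continuous_gaussAcc.continuousOn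
    ⟨by rw [hX]; exact hlow, by rw [gaussAcc_zero]; exact hp1⟩
  exact ⟨ℓ, hℓ, fun ℓ' hℓ' => strictAnti_gaussAcc.injective (hℓ'.trans hℓ.symm)⟩

/-- The gap at target `p` is positive. [ours] -/
theorem gaussLevel_pos {p ℓ : ℝ} (hp1 : p < 1) (h : gaussAcc ℓ = p) : 0 < ℓ := by
  by_contra hle
  have : gaussAcc 0 ≤ gaussAcc ℓ := antitone_gaussAcc (not_lt.mp hle)
  rw [gaussAcc_zero, h] at this
  linarith

/-- **THE REPLICA-COUNT LAW OF THE MODEL.**  With `ℓ_p` the gap of target `p < 1`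
(`gaussAcc ℓ_p = p`): the uniform `K`-interval ladder (`K ≥ 1`) of total stiffness `Λ` has every adjacent
acceptance `≥ p` iff `Λ/ℓ_p ≤ K` — the card's `N_r(p*) − 1 = G_tot/(2√2·erfcinv p*)`; by
`length_div_level_le_of_forall_acceptance` no ladder achieves it with fewer intervals. [ours] -/
theorem forall_gaussAcc_uniformLadder_iff {K : ℕ} (hK : 0 < K) {p ℓp : ℝ} (hp1 : p < 1)
    (hℓ : gaussAcc ℓp = p) (g₀ Λ : ℝ) :
    (∀ i ∈ range K, p ≤ gaussAcc (ladderGap (uniformLadder g₀ Λ K) i)) ↔ Λ / ℓp ≤ K :=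
  forall_acceptance_uniformLadder_iff hK strictAnti_gaussAcc hℓ (gaussLevel_pos hp1 hℓ) g₀ Λ

/-- Necessity for an ARBITRARY ladder: all adjacent acceptances `≥ p` forces `K ≥ Λ/ℓ_p`. [ours] -/
theorem length_div_gaussLevel_le {K : ℕ} (hK : 0 < K) (g : ℕ → ℝ) {p ℓp : ℝ} (hp1 : p < 1)
    (hℓ : gaussAcc ℓp = p) (hp : ∀ i ∈ range K, p ≤ gaussAcc (ladderGap g i)) :
    (g K - g 0) / ℓp ≤ K :=
  length_div_level_le_of_forall_acceptance hK g strictAnti_gaussAcc hℓ (gaussLevel_pos hp1 hℓ) hp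

end Level

/-! ## §5 (Appended, GEN-6) STRICT log-concavity: the equal-stiffness ladder is the UNIQUE maximiser of the
product of the adjacent acceptances (strict form of §3 / of `SwapLadderMinimax` §3 via its §5) -/

section Strict

/-- **`log ∘ erfc` is STRICTLY concave on `ℝ`** (its derivative `erfcLogDeriv` is strictly decreasing).
[folklore] -/
theorem strictConcaveOn_log_erfc : StrictConcaveOn ℝ univ (fun y => Real.log (erfc y)) := by
  refine StrictAnti.strictConcaveOn_univ_of_deriv (continuous_erfc.log fun x => (erfc_pos x).ne') ?_
  rw [deriv_log_erfc]
  exact strictAnti_erfcLogDeriv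

/-- **`log ∘ gaussAcc` is STRICTLY concave on `ℝ`.** [ours] -/
theorem strictConcaveOn_log_gaussAcc : StrictConcaveOn ℝ univ (fun y => Real.log (gaussAcc y)) := by
  refine StrictAnti.strictConcaveOn_univ_of_deriv
    (continuous_gaussAcc.log fun x => (gaussAcc_pos x).ne') ?_
  have hd : deriv (fun y => Real.log (gaussAcc y))
      = fun ℓ => erfcLogDeriv (ℓ / (2 * sqrt 2)) * (1 / (2 * sqrt 2)) :=
    funext fun ℓ => (hasDerivAt_log_gaussAcc ℓ).deriv
  rw [hd]
  intro a b hab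
  have hc : 0 < 1 / (2 * sqrt 2) := by positivity
  have h := strictAnti_erfcLogDeriv (div_lt_div_of_pos_right hab (by positivity : (0:ℝ) < 2 * sqrt 2))
  exact mul_lt_mul_of_pos_right h hc

/-- **Strict Jensen for a STRICTLY log-concave acceptance**: a `K`-interval ladder with some gap `≠ Λ/K`
has `Σ_i log A(gap_i) < K·log A(Λ/K)` (`SwapLadderMinimax.mul_cost_div_lt_sum_cost` for the strictly
convex cost `−log ∘ A`). [ours] -/
theorem sum_log_acceptance_lt {K : ℕ} (hK : 0 < K) (g : ℕ → ℝ) {A : ℝ → ℝ} {I : Set ℝ}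
    (hlogA : StrictConcaveOn ℝ I (fun x => Real.log (A x))) (hg : ∀ i ∈ range K, ladderGap g i ∈ I)
    (hne : ∃ i ∈ range K, ladderGap g i ≠ (g K - g 0) / K) :
    ∑ i ∈ range K, Real.log (A (ladderGap g i)) < K * Real.log (A ((g K - g 0) / K)) := by
  have h := mul_cost_div_lt_sum_cost hK g hlogA.neg hg hne
  simp only [Pi.neg_apply, sum_neg_distrib, mul_neg] at h
  linarith

/-- **A non-uniform ladder has a STRICTLY smaller product of acceptances**: `Π_i A(gap_i) < A(Λ/K)^K` for a
strictly log-concave `A`, positive on `I`. [ours] -/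
theorem prod_acceptance_lt_pow {K : ℕ} (hK : 0 < K) (g : ℕ → ℝ) {A : ℝ → ℝ} {I : Set ℝ}
    (hI : Convex ℝ I) (hApos : ∀ x ∈ I, 0 < A x) (hlogA : StrictConcaveOn ℝ I (fun x => Real.log (A x)))
    (hg : ∀ i ∈ range K, ladderGap g i ∈ I) (hne : ∃ i ∈ range K, ladderGap g i ≠ (g K - g 0) / K) :
    ∏ i ∈ range K, A (ladderGap g i) < A ((g K - g 0) / K) ^ K := by
  have hprodpos : 0 < ∏ i ∈ range K, A (ladderGap g i) := Finset.prod_pos fun i hi => hApos _ (hg i hi)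
  have hmean : (g K - g 0) / K ∈ I := length_div_mem_of_gaps_mem hK g hI hg
  have hApow : 0 < A ((g K - g 0) / K) ^ K := pow_pos (hApos _ hmean) K
  rw [← Real.log_lt_log_iff hprodpos hApow, Real.log_prod fun i hi => (hApos _ (hg i hi)).ne',
    Real.log_pow]
  exact sum_log_acceptance_lt hK g hlogA hg hne

/-- **In the Gaussian model the equal-stiffness ladder is the UNIQUE maximiser of the product of the adjacent
acceptances**: every other `K`-interval ladder with the same endpoints has `Π_i gaussAcc(gap_i) <
gaussAcc(Λ/K)^K` (cf. `prod_gaussAcc_le_pow`, `prod_gaussAcc_uniformLadder`). [ours] -/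
theorem prod_gaussAcc_lt_pow {K : ℕ} (hK : 0 < K) (g : ℕ → ℝ)
    (hne : ∃ i ∈ range K, ladderGap g i ≠ (g K - g 0) / K) :
    ∏ i ∈ range K, gaussAcc (ladderGap g i) < gaussAcc ((g K - g 0) / K) ^ K :=
  prod_acceptance_lt_pow hK g convex_univ (fun x _ => gaussAcc_pos x) strictConcaveOn_log_gaussAcc
    (fun _ _ => mem_univ _) hne

/-- Uniqueness form: a ladder whose product of Gaussian-model acceptances reaches the uniform value IS uniform.
[ours] -/
theorem ladderGap_eq_div_of_pow_le_prod_gaussAcc {K : ℕ} (hK : 0 < K) (g : ℕ → ℝ)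
    (h : gaussAcc ((g K - g 0) / K) ^ K ≤ ∏ i ∈ range K, gaussAcc (ladderGap g i)) :
    ∀ i ∈ range K, ladderGap g i = (g K - g 0) / K := by
  by_contra hcon
  push Not at hcon
  exact absurd h (not_le.mpr (prod_gaussAcc_lt_pow hK g hcon))

end Strict

end Summit.Ventures.LatticeQCDFlow.Scaling

end
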